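import Mathlib.Analysis.SpecialFunctions.Log.Basic
import Literature.Analysis.SpecialFunctions.EulerMascheroniBounds
import HarnessLib

/-!
# `NoHeavyLowerTail` (stmt-CriticalPhenomena-4575) — support file: the PARALLEL STEP of the logarithmic covariance
# bound `Cov(1{a↔c},1{b↔c}) ≤ P(ab|c)·log(P(a ↔ b off c)/P(ab|c))` (prover `prim-ineq-prove-2` gen 11, MEMO-20 §3)

Pure real-variable inequalities; no definitions, no named facts, no sorries, no measure theory.

A two-terminal hub network (graph `H` with terminals `a, b`, hub `c` joined to some vertices of `H`) has the six-cell
law of `(T, α_a, α_b) = (1{a ↔_H b}, 1{C_a attached to c}, 1{C_b attached to c})`: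
`t = P(T, attached)`, `w = P(T, unattached) = P(ab|c)`, and on `Tᶜ` the four cells `q = P(both attached)`,
`x = P(a unattached, b attached)`, `y = P(a attached, b unattached)`, `n = P(a|b|c)`; `t+w+q+x+y+n = 1`.
Then `θ = P(a ↔_H b) = t + w`, `P(a ↮ c, b ↮ c) = w + n`, `P(a ↮ c) = w + n + x`, `P(b ↮ c) = w + n + y`, and
`Cov(1{a↔c},1{b↔c}) = (w+n)(t+q) − x y`.  Two such networks on the same terminals and hub, internally disjoint,
compose IN PARALLEL by the explicit polynomial map used below (MEMO-18 §9.3): `P(a↮c,b↮c)`, `P(a|b|c)`,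
`P(a isolated) = n + x`, `P(b isolated) = n + y` and `1 − θ` are multiplicative.

* `GZParallel.mul_log_div_le` — one term of the log-sum inequality, from `log u ≤ u − 1`;
* `GZParallel.two_mul_mul_le_mul_log` — `2ns ≤ (2n+s)·n·log((n+s)/n)`, the Padé bound `log(1+t) ≥ 2t/(2+t)`
  (from `Literature.Analysis.SpecialFunctions.Real.two_div_le_log_one_add_inv`);
* `GZParallel.parallel_poly` — the polynomial core: under the two HARRIS constraints per factor
  `y(w+x) ≤ n(t+q)` (`P(a|b|c) ≥ P(a↮c)·P(b isolated)`) and `x(w+y) ≤ n(t+q)`, the composite covariance is at most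
  `z₂·Cov₁ + z₁·Cov₂ + w₁·2n₂s₂/(2n₂+s₂) + w₂·2n₁s₁/(2n₁+s₁)` (denominators cleared) — an explicit identity writing the
  slack as a sum of products of nonnegative quantities;
* `GZParallel.parallel_cov_sub_mul_log_le` — **LEMMA Π_H (quantitative):**
  `Cov − w·log(θ/w) ≤ z₂·(Cov₁ − w₁ log(θ₁/w₁)) + z₁·(Cov₂ − w₂ log(θ₂/w₂))` for the parallel composite;
* `GZParallel.parallel_cov_le_mul_log` — hence the class `{Cov ≤ w·log(θ/w)}` (with the Harris constraints) is closed under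
  parallel composition: the parallel step of THEOREM SP (MEMO-18 §9.4, MEMO-20 §4: the bound, and with it Gladkov–Zimin
  Conjecture 6.3 / Gladkov Conjecture 10.1 with modulus `w log(1/w)`, on every series–parallel `G − c`).

The probabilistic facts (that realizable laws satisfy the two Harris constraints, and that the parallel composite's law is the
polynomial map) are NOT in this file; they are elementary (Harris inequality; independence) and recorded in MEMO-20 §1–§2.
-/

noncomputable section

namespace Summit.CriticalPhenomena.PercolationContinuityZ3.Theorems

namespace GZParallel

/-- One term of the log-sum inequality: for positive `m, P, θ, w`,
`m·log(P/m) ≤ m·log(θ/w) + (P·w/θ − m)`; summing over terms with `Σ P = θ`, `Σ m = w` gives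
`Σ m log(P/m) ≤ w log(θ/w)`.  From `log u ≤ u − 1`. [folklore] -/
theorem mul_log_div_le {m P θ w : ℝ} (hm : 0 < m) (hP : 0 < P) (hθ : 0 < θ) (hw : 0 < w) :
    m * Real.log (P / m) ≤ m * Real.log (θ / w) + (P * w / θ - m) := by
  have hu : 0 < P * w / (m * θ) := by positivity
  have hlog : Real.log (P / m) - Real.log (θ / w) = Real.log (P * w / (m * θ)) := by
    rw [← Real.log_div (by positivity) (by positivity)]
    congr 1
    field_simp
  have h1 : Real.log (P * w / (m * θ)) ≤ P * w / (m * θ) - 1 := Real.log_le_sub_one_of_pos hu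
  have h2 : m * (P * w / (m * θ) - 1) = P * w / θ - m := by
    field_simp
  have h3 : m * (Real.log (P / m) - Real.log (θ / w)) ≤ m * (P * w / (m * θ) - 1) := by
    rw [hlog]; exact mul_le_mul_of_nonneg_left h1 hm.le
  rw [h2] at h3
  linarith

/-- The Padé lower bound `log(1 + s/n) ≥ 2s/(2n+s)` in product form: for `n > 0`, `s ≥ 0`,
`2·n·s ≤ (2n + s) · (n · log((n+s)/n))`. [folklore] -/
theorem two_mul_mul_le_mul_log {n s : ℝ} (hn : 0 < n) (hs : 0 ≤ s) :
    2 * n * s ≤ (2 * n + s) * (n * Real.log ((n + s) / n)) := by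
  rcases hs.eq_or_lt with h | h
  · subst h; simp
  · have ha : 0 < n / s := div_pos hn h
    have key := Literature.Analysis.SpecialFunctions.Real.two_div_le_log_one_add_inv ha
    have e1 : (1 : ℝ) + (n / s)⁻¹ = (n + s) / n := by
      field_simp
    have e2 : (2 : ℝ) / (2 * (n / s) + 1) = 2 * s / (2 * n + s) := by
      field_simp
    rw [e1, e2] at key
    have hD : 0 < 2 * n + s := by positivity
    have := (div_le_iff₀ hD).1 key
    nlinarith [this, hn]

/-- POLYNOMIAL CORE of the parallel step (MEMO-20 §3 (S)).  Per factor `i`: cells `w, q, x, y, n ≥ 0` with `n ≤ 1`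
(`t` eliminated: `e = t + q` is the free variable `e ≥ 0`), `z = w + n`, `s = x + y`, `Cov = z·e − x·y`, and the two
Harris slacks `σ = n e − y(w+x) ≥ 0`, `τ = n e − x(w+y) ≥ 0`.  Composite: `Z = z₁z₂`, `W = Z − n₁n₂`,
`U = (n₁+x₁)(n₂+x₂) + W`, `V = (n₁+y₁)(n₂+y₂) + W`, `C = Z − U·V` (this is the composite covariance when both cell
vectors sum to one, which is how it is used below).  Then, with `D_i = 2n_i + s_i`,
`D₁D₂·C ≤ D₁D₂(z₂Cov₁ + z₁Cov₂) + w₁D₁·2n₂s₂ + w₂D₂·2n₁s₁`, by the identity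
`slack = D₁D₂[Cov₁Cov₂ + W(x₁x₂+y₁y₂) + w₁w₂s₁s₂ + w₂(z₁s₁e₂ + (1+e₂−n₂)x₁y₁) + w₁(z₂s₂e₁ + (1+e₁−n₁)x₂y₂)]`
`+ w₂D₂[n₁(x₁−y₁)² + s₁(σ₁+τ₁)] + w₁D₁[n₂(x₂−y₂)² + s₂(σ₂+τ₂)]`, valid when each factor's cells sum to one. -/
theorem parallel_poly
    {w₁ x₁ y₁ e₁ n₁ w₂ x₂ y₂ e₂ n₂ : ℝ}
    (hw₁ : 0 ≤ w₁) (hx₁ : 0 ≤ x₁) (hy₁ : 0 ≤ y₁) (he₁ : 0 ≤ e₁) (hn₁ : 0 ≤ n₁)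
    (hw₂ : 0 ≤ w₂) (hx₂ : 0 ≤ x₂) (hy₂ : 0 ≤ y₂) (he₂ : 0 ≤ e₂) (hn₂ : 0 ≤ n₂)
    (hs₁ : w₁ + x₁ + y₁ + e₁ + n₁ = 1) (hs₂ : w₂ + x₂ + y₂ + e₂ + n₂ = 1)
    (H3₁ : y₁ * (w₁ + x₁) ≤ n₁ * e₁) (H4₁ : x₁ * (w₁ + y₁) ≤ n₁ * e₁)
    (H3₂ : y₂ * (w₂ + x₂) ≤ n₂ * e₂) (H4₂ : x₂ * (w₂ + y₂) ≤ n₂ * e₂) :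
    (2 * n₁ + (x₁ + y₁)) * (2 * n₂ + (x₂ + y₂)) *
        ((w₁ + n₁) * (w₂ + n₂) -
          ((n₁ + x₁) * (n₂ + x₂) + ((w₁ + n₁) * (w₂ + n₂) - n₁ * n₂)) *
            ((n₁ + y₁) * (n₂ + y₂) + ((w₁ + n₁) * (w₂ + n₂) - n₁ * n₂))) ≤
      (2 * n₁ + (x₁ + y₁)) * (2 * n₂ + (x₂ + y₂)) *
          ((w₂ + n₂) * ((w₁ + n₁) * e₁ - x₁ * y₁) + (w₁ + n₁) * ((w₂ + n₂) * e₂ - x₂ * y₂)) +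
        w₁ * (2 * n₁ + (x₁ + y₁)) * (2 * n₂ * (x₂ + y₂)) +
        w₂ * (2 * n₂ + (x₂ + y₂)) * (2 * n₁ * (x₁ + y₁)) := by
  -- the Harris slacks and the nonnegative building blocks
  have hσ₁ : 0 ≤ n₁ * e₁ - y₁ * (w₁ + x₁) := by linarith
  have hτ₁ : 0 ≤ n₁ * e₁ - x₁ * (w₁ + y₁) := by linarith
  have hσ₂ : 0 ≤ n₂ * e₂ - y₂ * (w₂ + x₂) := by linarith
  have hτ₂ : 0 ≤ n₂ * e₂ - x₂ * (w₂ + y₂) := by linarith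
  have hC₁ : 0 ≤ (w₁ + n₁) * e₁ - x₁ * y₁ := by nlinarith
  have hC₂ : 0 ≤ (w₂ + n₂) * e₂ - x₂ * y₂ := by nlinarith
  have hc₁ : 0 ≤ 1 + e₁ - n₁ := by linarith
  have hc₂ : 0 ≤ 1 + e₂ - n₂ := by linarith
  have hW : 0 ≤ w₁ * w₂ + w₁ * n₂ + n₁ * w₂ := by positivity
  have hN₁ : 0 ≤ n₁ * (x₁ - y₁) ^ 2 + (x₁ + y₁) * ((n₁ * e₁ - y₁ * (w₁ + x₁)) + (n₁ * e₁ - x₁ * (w₁ + y₁))) := by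
    positivity
  have hN₂ : 0 ≤ n₂ * (x₂ - y₂) ^ 2 + (x₂ + y₂) * ((n₂ * e₂ - y₂ * (w₂ + x₂)) + (n₂ * e₂ - x₂ * (w₂ + y₂))) := by
    positivity
  have hD₁ : 0 ≤ 2 * n₁ + (x₁ + y₁) := by positivity
  have hD₂ : 0 ≤ 2 * n₂ + (x₂ + y₂) := by positivity
  -- the sum of nonnegative terms
  have hsum : 0 ≤
      (2 * n₁ + (x₁ + y₁)) * (2 * n₂ + (x₂ + y₂)) *
          (((w₁ + n₁) * e₁ - x₁ * y₁) * ((w₂ + n₂) * e₂ - x₂ * y₂) +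
            (w₁ * w₂ + w₁ * n₂ + n₁ * w₂) * (x₁ * x₂ + y₁ * y₂) + w₁ * w₂ * ((x₁ + y₁) * (x₂ + y₂)) +
            w₂ * ((w₁ + n₁) * (x₁ + y₁) * e₂ + (1 + e₂ - n₂) * (x₁ * y₁)) +
            w₁ * ((w₂ + n₂) * (x₂ + y₂) * e₁ + (1 + e₁ - n₁) * (x₂ * y₂))) +
        w₂ * (2 * n₂ + (x₂ + y₂)) *
          (n₁ * (x₁ - y₁) ^ 2 + (x₁ + y₁) * ((n₁ * e₁ - y₁ * (w₁ + x₁)) + (n₁ * e₁ - x₁ * (w₁ + y₁)))) +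
        w₁ * (2 * n₁ + (x₁ + y₁)) *
          (n₂ * (x₂ - y₂) ^ 2 + (x₂ + y₂) * ((n₂ * e₂ - y₂ * (w₂ + x₂)) + (n₂ * e₂ - x₂ * (w₂ + y₂)))) := by
    have h1 : 0 ≤ ((w₁ + n₁) * e₁ - x₁ * y₁) * ((w₂ + n₂) * e₂ - x₂ * y₂) := mul_nonneg hC₁ hC₂
    have h2 : 0 ≤ (w₁ * w₂ + w₁ * n₂ + n₁ * w₂) * (x₁ * x₂ + y₁ * y₂) := by positivity
    have h3 : 0 ≤ w₁ * w₂ * ((x₁ + y₁) * (x₂ + y₂)) := by positivity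
    have h4 : 0 ≤ w₂ * ((w₁ + n₁) * (x₁ + y₁) * e₂ + (1 + e₂ - n₂) * (x₁ * y₁)) := by positivity
    have h5 : 0 ≤ w₁ * ((w₂ + n₂) * (x₂ + y₂) * e₁ + (1 + e₁ - n₁) * (x₂ * y₂)) := by positivity
    have h6 := mul_nonneg (mul_nonneg hD₁ hD₂) (add_nonneg (add_nonneg (add_nonneg (add_nonneg h1 h2) h3) h4) h5)
    have h7 := mul_nonneg (mul_nonneg hw₂ hD₂) hN₁
    have h8 := mul_nonneg (mul_nonneg hw₁ hD₁) hN₂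
    linarith
  -- eliminate e_i via the normalisations and close by the polynomial identity
  have he₁' : e₁ = 1 - w₁ - x₁ - y₁ - n₁ := by linarith
  have he₂' : e₂ = 1 - w₂ - x₂ - y₂ - n₂ := by linarith
  subst he₁' he₂'
  rw [← sub_nonneg]
  have key :
      (2 * n₁ + (x₁ + y₁)) * (2 * n₂ + (x₂ + y₂)) *
            ((w₂ + n₂) * ((w₁ + n₁) * (1 - w₁ - x₁ - y₁ - n₁) - x₁ * y₁) +
              (w₁ + n₁) * ((w₂ + n₂) * (1 - w₂ - x₂ - y₂ - n₂) - x₂ * y₂)) +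
          w₁ * (2 * n₁ + (x₁ + y₁)) * (2 * n₂ * (x₂ + y₂)) +
          w₂ * (2 * n₂ + (x₂ + y₂)) * (2 * n₁ * (x₁ + y₁)) -
        (2 * n₁ + (x₁ + y₁)) * (2 * n₂ + (x₂ + y₂)) *
          ((w₁ + n₁) * (w₂ + n₂) -
            ((n₁ + x₁) * (n₂ + x₂) + ((w₁ + n₁) * (w₂ + n₂) - n₁ * n₂)) *
              ((n₁ + y₁) * (n₂ + y₂) + ((w₁ + n₁) * (w₂ + n₂) - n₁ * n₂))) =
      (2 * n₁ + (x₁ + y₁)) * (2 * n₂ + (x₂ + y₂)) *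
          (((w₁ + n₁) * (1 - w₁ - x₁ - y₁ - n₁) - x₁ * y₁) * ((w₂ + n₂) * (1 - w₂ - x₂ - y₂ - n₂) - x₂ * y₂) +
            (w₁ * w₂ + w₁ * n₂ + n₁ * w₂) * (x₁ * x₂ + y₁ * y₂) + w₁ * w₂ * ((x₁ + y₁) * (x₂ + y₂)) +
            w₂ * ((w₁ + n₁) * (x₁ + y₁) * (1 - w₂ - x₂ - y₂ - n₂) + (1 + (1 - w₂ - x₂ - y₂ - n₂) - n₂) * (x₁ * y₁)) +
            w₁ * ((w₂ + n₂) * (x₂ + y₂) * (1 - w₁ - x₁ - y₁ - n₁) + (1 + (1 - w₁ - x₁ - y₁ - n₁) - n₁) * (x₂ * y₂))) +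
        w₂ * (2 * n₂ + (x₂ + y₂)) *
          (n₁ * (x₁ - y₁) ^ 2 + (x₁ + y₁) * ((n₁ * (1 - w₁ - x₁ - y₁ - n₁) - y₁ * (w₁ + x₁)) +
            (n₁ * (1 - w₁ - x₁ - y₁ - n₁) - x₁ * (w₁ + y₁)))) +
        w₁ * (2 * n₁ + (x₁ + y₁)) *
          (n₂ * (x₂ - y₂) ^ 2 + (x₂ + y₂) * ((n₂ * (1 - w₂ - x₂ - y₂ - n₂) - y₂ * (w₂ + x₂)) +
            (n₂ * (1 - w₂ - x₂ - y₂ - n₂) - x₂ * (w₂ + y₂)))) := by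
    ring
  rw [key]
  exact hsum

/-- **LEMMA Π_H — the parallel step, quantitative form** (MEMO-20 §3).  Two six-cell laws
`(tᵢ, wᵢ, qᵢ, xᵢ, yᵢ, nᵢ)` (`wᵢ, nᵢ > 0`, cells summing to one) satisfying the two Harris constraints
`yᵢ(wᵢ+xᵢ) ≤ nᵢ(tᵢ+qᵢ)` and `xᵢ(wᵢ+yᵢ) ≤ nᵢ(tᵢ+qᵢ)`; composite (parallel map) `Z = z₁z₂` (`zᵢ = wᵢ+nᵢ`),
`W = Z − n₁n₂`, `U = (n₁+x₁)(n₂+x₂) + W`, `V = (n₁+y₁)(n₂+y₂) + W`, `θ = θ₁ + θ₂ − θ₁θ₂` (`θᵢ = tᵢ + wᵢ`),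
composite covariance `C = Z − U·V`, factor covariances `Cᵢ = zᵢ(tᵢ+qᵢ) − xᵢyᵢ`.  Then
`C − W·log(θ/W) ≤ z₂·(C₁ − w₁·log(θ₁/w₁)) + z₁·(C₂ − w₂·log(θ₂/w₂))`.
Proof: log-sum inequality over the three cases `T₁T₂ᶜ, T₁ᶜT₂, T₁T₂` (masses `w₁n₂, n₁w₂, w₁w₂`, probabilities
`θ₁(1−θ₂), (1−θ₁)θ₂, θ₁θ₂`), the Padé bound `log(1+s/n) ≥ 2s/(2n+s)` with `1 − θᵢ ≥ nᵢ + xᵢ + yᵢ`, and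
`parallel_poly`. -/
theorem parallel_cov_sub_mul_log_le {t₁ w₁ q₁ x₁ y₁ n₁ t₂ w₂ q₂ x₂ y₂ n₂ : ℝ}
    (ht₁ : 0 ≤ t₁) (hw₁ : 0 < w₁) (hq₁ : 0 ≤ q₁) (hx₁ : 0 ≤ x₁) (hy₁ : 0 ≤ y₁) (hn₁ : 0 < n₁)
    (ht₂ : 0 ≤ t₂) (hw₂ : 0 < w₂) (hq₂ : 0 ≤ q₂) (hx₂ : 0 ≤ x₂) (hy₂ : 0 ≤ y₂) (hn₂ : 0 < n₂)
    (hs₁ : t₁ + w₁ + q₁ + x₁ + y₁ + n₁ = 1) (hs₂ : t₂ + w₂ + q₂ + x₂ + y₂ + n₂ = 1)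
    (H3₁ : y₁ * (w₁ + x₁) ≤ n₁ * (t₁ + q₁)) (H4₁ : x₁ * (w₁ + y₁) ≤ n₁ * (t₁ + q₁))
    (H3₂ : y₂ * (w₂ + x₂) ≤ n₂ * (t₂ + q₂)) (H4₂ : x₂ * (w₂ + y₂) ≤ n₂ * (t₂ + q₂)) :
    ((w₁ + n₁) * (w₂ + n₂) -
          ((n₁ + x₁) * (n₂ + x₂) + ((w₁ + n₁) * (w₂ + n₂) - n₁ * n₂)) *
            ((n₁ + y₁) * (n₂ + y₂) + ((w₁ + n₁) * (w₂ + n₂) - n₁ * n₂))) -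
        ((w₁ + n₁) * (w₂ + n₂) - n₁ * n₂) *
          Real.log (((t₁ + w₁) + (t₂ + w₂) - (t₁ + w₁) * (t₂ + w₂)) / ((w₁ + n₁) * (w₂ + n₂) - n₁ * n₂)) ≤
      (w₂ + n₂) * (((w₁ + n₁) * (t₁ + q₁) - x₁ * y₁) - w₁ * Real.log ((t₁ + w₁) / w₁)) +
        (w₁ + n₁) * (((w₂ + n₂) * (t₂ + q₂) - x₂ * y₂) - w₂ * Real.log ((t₂ + w₂) / w₂)) := by
  -- abbreviations
  set θ₁ := t₁ + w₁ with hθ₁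
  set θ₂ := t₂ + w₂ with hθ₂
  set z₁ := w₁ + n₁ with hz₁
  set z₂ := w₂ + n₂ with hz₂
  set s₁ := x₁ + y₁ with hs₁'
  set s₂ := x₂ + y₂ with hs₂'
  set W := z₁ * z₂ - n₁ * n₂ with hW
  set θ := θ₁ + θ₂ - θ₁ * θ₂ with hθ
  set C₁ := z₁ * (t₁ + q₁) - x₁ * y₁ with hC₁
  set C₂ := z₂ * (t₂ + q₂) - x₂ * y₂ with hC₂
  set C := z₁ * z₂ - ((n₁ + x₁) * (n₂ + x₂) + W) * ((n₁ + y₁) * (n₂ + y₂) + W) with hC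
  -- positivity
  have hθ₁pos : 0 < θ₁ := by rw [hθ₁]; linarith
  have hθ₂pos : 0 < θ₂ := by rw [hθ₂]; linarith
  have h1θ₁ : 1 - θ₁ = q₁ + x₁ + y₁ + n₁ := by rw [hθ₁]; linarith
  have h1θ₂ : 1 - θ₂ = q₂ + x₂ + y₂ + n₂ := by rw [hθ₂]; linarith
  have h1θ₁pos : 0 < 1 - θ₁ := by rw [h1θ₁]; linarith
  have h1θ₂pos : 0 < 1 - θ₂ := by rw [h1θ₂]; linarith
  have hWeq : W = w₁ * n₂ + n₁ * w₂ + w₁ * w₂ := by rw [hW, hz₁, hz₂]; ring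
  have hWpos : 0 < W := by rw [hWeq]; positivity
  have hθeq : θ = θ₁ * (1 - θ₂) + (1 - θ₁) * θ₂ + θ₁ * θ₂ := by rw [hθ]; ring
  have hθpos : 0 < θ := by rw [hθeq]; positivity
  have hz₁pos : 0 < z₁ := by rw [hz₁]; linarith
  have hz₂pos : 0 < z₂ := by rw [hz₂]; linarith
  have hD₁ : 0 < 2 * n₁ + s₁ := by rw [hs₁']; positivity
  have hD₂ : 0 < 2 * n₂ + s₂ := by rw [hs₂']; positivity
  -- (S) the polynomial core
  have hpoly := parallel_poly hw₁.le hx₁ hy₁ (by positivity : (0:ℝ) ≤ t₁ + q₁) hn₁.le hw₂.le hx₂ hy₂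
    (by positivity : (0:ℝ) ≤ t₂ + q₂) hn₂.le (by linarith) (by linarith) H3₁ H4₁ H3₂ H4₂
  -- (H) Padé bound and monotonicity of log: 2 nᵢ sᵢ ≤ Dᵢ · nᵢ · log((1−θᵢ)/nᵢ)
  have hL₁ : Real.log ((n₁ + s₁) / n₁) ≤ Real.log ((1 - θ₁) / n₁) := by
    apply Real.log_le_log (by positivity)
    apply div_le_div_of_nonneg_right _ hn₁.le
    rw [h1θ₁, hs₁']; linarith
  have hL₂ : Real.log ((n₂ + s₂) / n₂) ≤ Real.log ((1 - θ₂) / n₂) := by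
    apply Real.log_le_log (by positivity)
    apply div_le_div_of_nonneg_right _ hn₂.le
    rw [h1θ₂, hs₂']; linarith
  have hP₁ : 2 * n₁ * s₁ ≤ (2 * n₁ + s₁) * (n₁ * Real.log ((1 - θ₁) / n₁)) := by
    have h := two_mul_mul_le_mul_log hn₁ (by rw [hs₁']; positivity : (0:ℝ) ≤ s₁)
    have h' : (2 * n₁ + s₁) * (n₁ * Real.log ((n₁ + s₁) / n₁)) ≤ (2 * n₁ + s₁) * (n₁ * Real.log ((1 - θ₁) / n₁)) :=
      mul_le_mul_of_nonneg_left (mul_le_mul_of_nonneg_left hL₁ hn₁.le) hD₁.le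
    linarith
  have hP₂ : 2 * n₂ * s₂ ≤ (2 * n₂ + s₂) * (n₂ * Real.log ((1 - θ₂) / n₂)) := by
    have h := two_mul_mul_le_mul_log hn₂ (by rw [hs₂']; positivity : (0:ℝ) ≤ s₂)
    have h' : (2 * n₂ + s₂) * (n₂ * Real.log ((n₂ + s₂) / n₂)) ≤ (2 * n₂ + s₂) * (n₂ * Real.log ((1 - θ₂) / n₂)) :=
      mul_le_mul_of_nonneg_left (mul_le_mul_of_nonneg_left hL₂ hn₂.le) hD₂.le
    linarith
  -- combine (S) and (H): C ≤ z₂ C₁ + z₁ C₂ + w₁ n₂ L₂ + w₂ n₁ L₁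
  have hSH : C ≤ z₂ * C₁ + z₁ * C₂ + w₁ * (n₂ * Real.log ((1 - θ₂) / n₂)) + w₂ * (n₁ * Real.log ((1 - θ₁) / n₁)) := by
    have e1 : w₁ * (2 * n₁ + s₁) * (2 * n₂ * s₂) ≤ w₁ * (2 * n₁ + s₁) * ((2 * n₂ + s₂) * (n₂ * Real.log ((1 - θ₂) / n₂))) :=
      mul_le_mul_of_nonneg_left hP₂ (by positivity)
    have e2 : w₂ * (2 * n₂ + s₂) * (2 * n₁ * s₁) ≤ w₂ * (2 * n₂ + s₂) * ((2 * n₁ + s₁) * (n₁ * Real.log ((1 - θ₁) / n₁))) :=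
      mul_le_mul_of_nonneg_left hP₁ (by positivity)
    have e3 : (2 * n₁ + s₁) * (2 * n₂ + s₂) * C ≤ (2 * n₁ + s₁) * (2 * n₂ + s₂) *
        (z₂ * C₁ + z₁ * C₂ + w₁ * (n₂ * Real.log ((1 - θ₂) / n₂)) + w₂ * (n₁ * Real.log ((1 - θ₁) / n₁))) := by
      have : (2 * n₁ + s₁) * (2 * n₂ + s₂) *
          (z₂ * C₁ + z₁ * C₂ + w₁ * (n₂ * Real.log ((1 - θ₂) / n₂)) + w₂ * (n₁ * Real.log ((1 - θ₁) / n₁))) =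
          (2 * n₁ + s₁) * (2 * n₂ + s₂) * (z₂ * C₁ + z₁ * C₂) +
            w₁ * (2 * n₁ + s₁) * ((2 * n₂ + s₂) * (n₂ * Real.log ((1 - θ₂) / n₂))) +
            w₂ * (2 * n₂ + s₂) * ((2 * n₁ + s₁) * (n₁ * Real.log ((1 - θ₁) / n₁))) := by ring
      rw [this]
      have hp : (2 * n₁ + s₁) * (2 * n₂ + s₂) * C ≤ (2 * n₁ + s₁) * (2 * n₂ + s₂) * (z₂ * C₁ + z₁ * C₂) +
          w₁ * (2 * n₁ + s₁) * (2 * n₂ * s₂) + w₂ * (2 * n₂ + s₂) * (2 * n₁ * s₁) := by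
        simpa [hs₁', hs₂', hz₁, hz₂, hC, hC₁, hC₂, hW] using hpoly
      linarith
    exact le_of_mul_le_mul_left e3 (by positivity)
  -- (J) the log-sum inequality over the three cases
  have hJ₁ := mul_log_div_le (m := w₁ * n₂) (P := θ₁ * (1 - θ₂)) (by positivity) (by positivity) hθpos hWpos
  have hJ₂ := mul_log_div_le (m := n₁ * w₂) (P := (1 - θ₁) * θ₂) (by positivity) (by positivity) hθpos hWpos
  have hJ₃ := mul_log_div_le (m := w₁ * w₂) (P := θ₁ * θ₂) (by positivity) (by positivity) hθpos hWpos
  have hsumP : θ₁ * (1 - θ₂) * W / θ + (1 - θ₁) * θ₂ * W / θ + θ₁ * θ₂ * W / θ = W := by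
    rw [hθeq]; field_simp
  have hJ : w₁ * n₂ * Real.log (θ₁ * (1 - θ₂) / (w₁ * n₂)) + n₁ * w₂ * Real.log ((1 - θ₁) * θ₂ / (n₁ * w₂)) +
      w₁ * w₂ * Real.log (θ₁ * θ₂ / (w₁ * w₂)) ≤ W * Real.log (θ / W) := by
    have : (w₁ * n₂ + n₁ * w₂ + w₁ * w₂) * Real.log (θ / W) = W * Real.log (θ / W) := by rw [hWeq]
    linarith
  -- split the logarithms
  have hsplit₁ : Real.log (θ₁ * (1 - θ₂) / (w₁ * n₂)) = Real.log (θ₁ / w₁) + Real.log ((1 - θ₂) / n₂) := by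
    rw [mul_div_mul_comm, Real.log_mul (by positivity) (by positivity)]
  have hsplit₂ : Real.log ((1 - θ₁) * θ₂ / (n₁ * w₂)) = Real.log ((1 - θ₁) / n₁) + Real.log (θ₂ / w₂) := by
    rw [mul_div_mul_comm, Real.log_mul (by positivity) (by positivity)]
  have hsplit₃ : Real.log (θ₁ * θ₂ / (w₁ * w₂)) = Real.log (θ₁ / w₁) + Real.log (θ₂ / w₂) := by
    rw [mul_div_mul_comm, Real.log_mul (by positivity) (by positivity)]
  rw [hsplit₁, hsplit₂, hsplit₃] at hJ
  -- assemble (a linear combination once `z₂ w₁ = w₁ n₂ + w₁ w₂`, `z₁ w₂ = n₁ w₂ + w₁ w₂` are used)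
  have hzw₁ : z₂ * (w₁ * Real.log (θ₁ / w₁)) = (w₁ * n₂ + w₁ * w₂) * Real.log (θ₁ / w₁) := by rw [hz₂]; ring
  have hzw₂ : z₁ * (w₂ * Real.log (θ₂ / w₂)) = (n₁ * w₂ + w₁ * w₂) * Real.log (θ₂ / w₂) := by rw [hz₁]; ring
  have hfin : C - W * Real.log (θ / W) ≤
      z₂ * (C₁ - w₁ * Real.log (θ₁ / w₁)) + z₁ * (C₂ - w₂ * Real.log (θ₂ / w₂)) := by
    have e : z₂ * (C₁ - w₁ * Real.log (θ₁ / w₁)) + z₁ * (C₂ - w₂ * Real.log (θ₂ / w₂)) =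
        z₂ * C₁ + z₁ * C₂ - z₂ * (w₁ * Real.log (θ₁ / w₁)) - z₁ * (w₂ * Real.log (θ₂ / w₂)) := by ring
    rw [e, hzw₁, hzw₂]
    linear_combination hSH + hJ
  exact hfin

/-- **Parallel closure of the logarithmic covariance bound** (the parallel step of THEOREM SP, MEMO-20 §4):
if both factors satisfy `Covᵢ ≤ wᵢ·log(θᵢ/wᵢ)` (and the two Harris constraints), then the parallel composite satisfies
`Cov ≤ W·log(θ/W)`, in the cell coordinates of `parallel_cov_sub_mul_log_le`. -/
theorem parallel_cov_le_mul_log {t₁ w₁ q₁ x₁ y₁ n₁ t₂ w₂ q₂ x₂ y₂ n₂ : ℝ}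
    (ht₁ : 0 ≤ t₁) (hw₁ : 0 < w₁) (hq₁ : 0 ≤ q₁) (hx₁ : 0 ≤ x₁) (hy₁ : 0 ≤ y₁) (hn₁ : 0 < n₁)
    (ht₂ : 0 ≤ t₂) (hw₂ : 0 < w₂) (hq₂ : 0 ≤ q₂) (hx₂ : 0 ≤ x₂) (hy₂ : 0 ≤ y₂) (hn₂ : 0 < n₂)
    (hs₁ : t₁ + w₁ + q₁ + x₁ + y₁ + n₁ = 1) (hs₂ : t₂ + w₂ + q₂ + x₂ + y₂ + n₂ = 1)
    (H3₁ : y₁ * (w₁ + x₁) ≤ n₁ * (t₁ + q₁)) (H4₁ : x₁ * (w₁ + y₁) ≤ n₁ * (t₁ + q₁))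
    (H3₂ : y₂ * (w₂ + x₂) ≤ n₂ * (t₂ + q₂)) (H4₂ : x₂ * (w₂ + y₂) ≤ n₂ * (t₂ + q₂))
    (L₁ : (w₁ + n₁) * (t₁ + q₁) - x₁ * y₁ ≤ w₁ * Real.log ((t₁ + w₁) / w₁))
    (L₂ : (w₂ + n₂) * (t₂ + q₂) - x₂ * y₂ ≤ w₂ * Real.log ((t₂ + w₂) / w₂)) :
    (w₁ + n₁) * (w₂ + n₂) -
          ((n₁ + x₁) * (n₂ + x₂) + ((w₁ + n₁) * (w₂ + n₂) - n₁ * n₂)) *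
            ((n₁ + y₁) * (n₂ + y₂) + ((w₁ + n₁) * (w₂ + n₂) - n₁ * n₂)) ≤
        ((w₁ + n₁) * (w₂ + n₂) - n₁ * n₂) *
          Real.log (((t₁ + w₁) + (t₂ + w₂) - (t₁ + w₁) * (t₂ + w₂)) / ((w₁ + n₁) * (w₂ + n₂) - n₁ * n₂)) := by
  have h := parallel_cov_sub_mul_log_le ht₁ hw₁ hq₁ hx₁ hy₁ hn₁ ht₂ hw₂ hq₂ hx₂ hy₂ hn₂ hs₁ hs₂ H3₁ H4₁ H3₂ H4₂
  have hz₁ : 0 ≤ w₁ + n₁ := by linarith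
  have hz₂ : 0 ≤ w₂ + n₂ := by linarith
  have e₁ : (w₂ + n₂) * (((w₁ + n₁) * (t₁ + q₁) - x₁ * y₁) - w₁ * Real.log ((t₁ + w₁) / w₁)) ≤ 0 :=
    mul_nonpos_of_nonneg_of_nonpos hz₂ (by linarith)
  have e₂ : (w₁ + n₁) * (((w₂ + n₂) * (t₂ + q₂) - x₂ * y₂) - w₂ * Real.log ((t₂ + w₂) / w₂)) ≤ 0 :=
    mul_nonpos_of_nonneg_of_nonpos hz₁ (by linarith)
  linarith

end GZParallel

end Summit.CriticalPhenomena.PercolationContinuityZ3.Theorems
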